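import Literature.NumberTheory.Transcendental.HolonomyBoundCharacteristic
import Mathlib.RingTheory.PowerSeries.Basic
import Mathlib.Tactic
import HarnessLib

/-!
# The basic holonomy bounds for `ℚ(x)`-linearly independent power series (CDT App. §17, summary)

Calegari–Dimitrov–Tang, arXiv:2408.15403, Appendix §17 states its bounds for "a `ℚ(x)`-linearly
independent set of formal functions `f₁, …, f_m ∈ ℚ⟦x⟧`". For formal power series this means:
no relation `Σ rᵢ fᵢ = 0` with `rᵢ ∈ ℚ(x)` not all zero — equivalently, clearing denominators,
linear independence over `ℚ[x]` of the `fᵢ` in the `ℚ[x]`-module `ℚ⟦x⟧`. The files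
`HolonomyBoundBasic/Meromorphic/Characteristic` take this hypothesis in the unfolded form
"`(i, j) ↦ xʲ fᵢ` (`j < D`) is `ℚ`-linearly independent for every `D`" (injectivity of the
evaluation maps `ψ_D`, §17.1). This file supplies the one-line translation and restates the
three bounds with the hypothesis `LinearIndependent ℚ[X] (fser b a)`:

* `HolonomyBound.linearIndependent_X_pow_mul` — `ℚ[x]`-independence ⇒ injectivity of all `ψ_D`.
* `HolonomyBound.holonomyBound_basic'` — eq. (PZ final), holomorphic `φ`, `u = h = 1`:
  `m (log|φ'(0)| − Σ bⱼ) ≤ 2 log sup_𝕋 max(1,|φ|)`.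
* `HolonomyBound.holonomyBound_nevanlinna'` — eq. (17.1) for holomorphic `φ`:
  `m (log|φ'(0)| − Σ bⱼ) ≤ 2 ⨍_𝕋 log⁺|φ|`.
* `HolonomyBound.holonomyBound_nevanlinna_meromorphic'` — eq. (17.1) for `φ = ψ/χ` without
  poles on `𝕋`: `m (log|φ'(0)| − Σ bⱼ) ≤ 2 T(φ)`.

No named facts.

## References

* [CalegariDimitrovTang2024] arXiv:2408.15403, Appendix §17 (pp. 129–130).
-/

noncomputable section

open PowerSeries Filter Metric Real Set Topology

namespace Literature.NumberTheory.Transcendental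

namespace HolonomyBound

variable {m r : ℕ}

/-- `ℚ(x)`-linear independence of power series `f₁,…,f_m ∈ ℚ⟦x⟧`, in the cleared-denominators
form of linear independence over `ℚ[x]`, gives the `ℚ`-linear independence of the family
`X^j fᵢ` (`j < D`) for every `D`, i.e. the injectivity of every evaluation map `ψ_D`
(the form in which the holonomy bounds of this directory take their hypothesis).
[cite: CalegariDimitrovTang2024, Appendix §17.1: "By the assumed ℚ(x)-linear independence of the m formal power series fᵢ(x) ∈ ℚ⟦x⟧, the evaluation map ψ_D … is injective" (p. 129)] -/
theorem linearIndependent_X_pow_mul (f : Fin m → ℚ⟦X⟧)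
    (h : LinearIndependent (Polynomial ℚ) f) (D : ℕ) :
    LinearIndependent ℚ (fun ij : Fin m × Fin D => (X : ℚ⟦X⟧) ^ (ij.2 : ℕ) * f ij.1) := by
  classical
  rw [Fintype.linearIndependent_iff]
  intro c hc ij
  -- regroup: `Σ_{i,j} c (i,j) X^j fᵢ = Σ_i pᵢ • fᵢ` with `pᵢ = Σ_j c(i,j) X^j ∈ ℚ[x]`
  set p : Fin m → Polynomial ℚ :=
    fun i => ∑ j : Fin D, Polynomial.C (c (i, j)) * Polynomial.X ^ (j : ℕ) with hp
  have hcoe : ∀ i, ((p i : Polynomial ℚ) : ℚ⟦X⟧) =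
      ∑ j : Fin D, PowerSeries.C (c (i, j)) * (X : ℚ⟦X⟧) ^ (j : ℕ) := by
    intro i
    rw [show ((p i : Polynomial ℚ) : ℚ⟦X⟧) = Polynomial.coeToPowerSeries.ringHom (p i) from rfl,
      hp, map_sum]
    simp only [Polynomial.coeToPowerSeries.ringHom_apply, Polynomial.coe_mul, Polynomial.coe_C,
      Polynomial.coe_pow, Polynomial.coe_X]
  have hsum : ∑ i, p i • f i = 0 := by
    rw [← hc, Fintype.sum_prod_type]
    refine Finset.sum_congr rfl fun i _ => ?_
    rw [Algebra.smul_def, PowerSeries.algebraMap_apply', Algebra.algebraMap_self, PowerSeries.map_id,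
      id_eq, hcoe i, Finset.sum_mul]
    refine Finset.sum_congr rfl fun j _ => ?_
    rw [PowerSeries.smul_eq_C_mul, mul_assoc]
  have hp0 : ∀ i, p i = 0 := Fintype.linearIndependent_iff.mp h p hsum
  have := congr_arg (fun q : Polynomial ℚ => q.coeff (ij.2 : ℕ)) (hp0 ij.1)
  simp only [hp, Polynomial.finsetSum_coeff, Polynomial.coeff_C_mul_X_pow,
    Polynomial.coeff_zero] at this
  rw [Finset.sum_eq_single ij.2 (fun j _ hj => if_neg (fun h => hj (Fin.ext h.symm)))
    (fun h => absurd (Finset.mem_univ _) h), if_pos rfl] at this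
  exact this

/-- **Eq. (PZ final), holomorphic case**, for `ℚ(x)`-linearly independent `fᵢ = Σ a i k/den b k · x^k`.
[cite: CalegariDimitrovTang2024, Appendix §17 eq. (PZ final) (p. 130)] -/
theorem holonomyBound_basic' (b : Fin r → ℕ) (a : Fin m → ℕ → ℤ)
    (hindep : LinearIndependent (Polynomial ℚ) (fser b a))
    {φ : ℂ → ℂ} {g : Fin m → ℂ → ℂ} {R₀ M G : ℝ} (hR₀ : 1 < R₀)
    (hφ : DifferentiableOn ℂ φ (ball (0 : ℂ) R₀)) (hφ0 : φ 0 = 0)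
    (hg : ∀ i, DifferentiableOn ℂ (g i) (ball (0 : ℂ) R₀))
    (hgerm : ∀ i, ∀ᶠ z in 𝓝 (0 : ℂ), HasSum (fun k => (cfOf b a i k : ℂ) * φ z ^ k) (g i z))
    (hM1 : 1 ≤ M) (hM : ∀ z : ℂ, ‖z‖ = 1 → ‖φ z‖ ≤ M)
    (hGz : ∀ i (z : ℂ), ‖z‖ = 1 → ‖g i z‖ ≤ G) :
    (m : ℝ) * (Real.log ‖deriv φ 0‖ - ∑ j, (b j : ℝ)) ≤ 2 * Real.log M :=
  holonomyBound_basic b a (fun D => linearIndependent_X_pow_mul _ hindep D) hR₀ hφ hφ0 hg hgerm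
    hM1 hM hGz

/-- **Eq. (17.1) = (basic basic), holomorphic `φ`**, for `ℚ(x)`-linearly independent `fᵢ`:
`m (log|φ'(0)| − Σ bⱼ) ≤ 2 ⨍_𝕋 log⁺|φ| = 2 T(φ)`.
[cite: CalegariDimitrovTang2024, Appendix §17 eq. (17.1) (p. 129)] -/
theorem holonomyBound_nevanlinna' (b : Fin r → ℕ) (a : Fin m → ℕ → ℤ)
    (hindep : LinearIndependent (Polynomial ℚ) (fser b a))
    {φ h : ℂ → ℂ} {G g : Fin m → ℂ → ℂ} {R₀ G' : ℝ} (hR₀ : 1 < R₀)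
    (hφ : DifferentiableOn ℂ φ (ball (0 : ℂ) R₀)) (hφ0 : φ 0 = 0)
    (hh : ContinuousAt h 0) (hh0 : h 0 = 1)
    (hG : ∀ i, DifferentiableOn ℂ (G i) (ball (0 : ℂ) R₀))
    (hgerm : ∀ i, ∀ᶠ z in 𝓝 (0 : ℂ), HasSum (fun k => (cfOf b a i k : ℂ) * φ z ^ k) (g i z))
    (hGg : ∀ i, ∀ᶠ z in 𝓝 (0 : ℂ), G i z = h z * g i z)
    (hGz : ∀ i (z : ℂ), ‖z‖ = 1 → ‖G i z‖ ≤ G') :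
    (m : ℝ) * (Real.log ‖deriv φ 0‖ - ∑ j, (b j : ℝ)) ≤
      2 * circleAverage (fun z => log⁺ ‖φ z‖) 0 1 :=
  holonomyBound_nevanlinna b a (fun D => linearIndependent_X_pow_mul _ hindep D) hR₀ hφ hφ0 hh
    hh0 hG hgerm hGg hGz

/-- **Eq. (17.1) = (basic basic), meromorphic `φ = ψ/χ` without poles on `𝕋`**, for
`ℚ(x)`-linearly independent `fᵢ`: `m (log|φ'(0)| − Σ bⱼ) ≤ 2 T(φ)`,
`T(φ) = ⨍_𝕋 log⁺|φ| + Σ_{poles ρ ∈ 𝔻} mult(ρ) log(1/|ρ|)`.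
[cite: CalegariDimitrovTang2024, Appendix §17 eqs. (17.1), (17.2) (p. 129)] -/
theorem holonomyBound_nevanlinna_meromorphic' (b : Fin r → ℕ) (a : Fin m → ℕ → ℤ)
    (hindep : LinearIndependent (Polynomial ℚ) (fser b a))
    {ψ χ h : ℂ → ℂ} {G g : Fin m → ℂ → ℂ} {R₀ G' : ℝ} (hR₀ : 1 < R₀)
    (hψ : DifferentiableOn ℂ ψ (ball (0 : ℂ) R₀)) (hχ : DifferentiableOn ℂ χ (ball (0 : ℂ) R₀))
    (hψ0 : ψ 0 = 0) (hχ0 : χ 0 ≠ 0) (hχT : ∀ z : ℂ, ‖z‖ = 1 → χ z ≠ 0)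
    (hh : ContinuousAt h 0) (hh0 : h 0 = 1)
    (hG : ∀ i, DifferentiableOn ℂ (G i) (ball (0 : ℂ) R₀))
    (hgerm : ∀ i, ∀ᶠ z in 𝓝 (0 : ℂ),
      HasSum (fun k => (cfOf b a i k : ℂ) * (ψ z / χ z) ^ k) (g i z))
    (hGg : ∀ i, ∀ᶠ z in 𝓝 (0 : ℂ), G i z = h z * g i z)
    (hGz : ∀ i (z : ℂ), ‖z‖ = 1 → ‖G i z‖ ≤ G') :
    (m : ℝ) * (Real.log ‖deriv (fun z => ψ z / χ z) 0‖ - ∑ j, (b j : ℝ)) ≤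
      2 * (circleAverage (fun z => log⁺ ‖ψ z / χ z‖) 0 1 +
        ∑ᶠ x, ((MeromorphicOn.divisor (ψ / χ) (closedBall (0 : ℂ) 1) x)⁻ : ℤ) *
          Real.log (‖x‖⁻¹)) :=
  holonomyBound_nevanlinna_meromorphic b a (fun D => linearIndependent_X_pow_mul _ hindep D) hR₀
    hψ hχ hψ0 hχ0 hχT hh hh0 hG hgerm hGg hGz

end HolonomyBound

end Literature.NumberTheory.Transcendental
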